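import Mathlib.MeasureTheory.Measure.Typeclasses.Probability
import Mathlib.MeasureTheory.Measure.AEMeasurable
import Mathlib.MeasureTheory.Measure.Dirac
import Mathlib.Combinatorics.SimpleGraph.Walk.Maps
import Literature.Probability.RandomPlanarGeometry.BlobTime
import Literature.Probability.RandomPlanarGeometry.BlobTimePartition
import Literature.Probability.RandomPlanarGeometry.SelfAvoidingWalk
import HarnessLib

/-!
# The critical blob-time chordal law of a discrete domain

Topic `Literature/Probability/RandomPlanarGeometry` (definition item `defn-BlobTime.domainLaw`, for
route SAWCutPointCondensation of `CriticalPhenomena/SAWScalingLimit`, whose items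
CutPointWindowLimit, CondensationLimit, CondensateCovariance, PenaltyUniversality, BlobZeroIsSAW,
BlobLawDichotomy each inline, twice, the ≈ 600-character measure named here).

For a blob fugacity `t : ℝ` (intended `t ∈ [0, 1]`, `t = e^{-λ}`), a nearest-neighbour walk
`p` of length `|p|` with blob time `B(p) = |p| - #{cut times of p}`
(`Literature.Probability.RandomPlanarGeometry.BlobTime.blobTime`, file `BlobTime.lean`) gets the
weight `w_t(p) = y_c(t)^{|p|} · t^{B(p)}`, where `y_c(t) = 1/μ_B(t)` is the whole-plane critical
fugacity of the blob-time-penalised walk on `ℤ²` (`BlobTime.criticalFugacity`, file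
`BlobTimePartition.lean`). The **critical blob-time chordal law** of the discrete domain
`Ω_δ ⊆ δℤ²` (`discreteDomainGraph Ω δ`, Smirnov's largest-component convention) from `a` to `b`
is the probability law `∝ Σ_p w_t(p) δ_{curve(p)}` over ALL walks `p` of `Ω_δ` from `a` to `b`,
pushed to the space `CurveClass ℂ` of curves modulo reparametrisation (polyline through the mesh
points, `SimpleGraph.Walk.toCurve (meshPoint δ)`), normalised by its total mass (junk value `0`
when `a, b` are not joined in `Ω_δ`, or if the mass were infinite). At `t = 1` the weight is
`y_c(1)^{|p|}` with `y_c(1) = 1/μ_B(1)` (`= 1/4`, as `b_n(1) = 4ⁿ`): the Green-normalised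
simple-random-walk path measure from `a` to `b` in `Ω_δ`; at `t = 0` it is the critical
self-avoiding-walk law `SAW.law` pushed to curves (`domainLaw_zero`, proved here) — the two ends
of the route's flow. This is the genre of Lawler–Schramm–Werner's measures on discrete paths in a
domain weighted by `β^{-|ω|}` and normalised (`m^#`) [LSW 2004, §2, §3.1, §3.4.2], with the
Domb–Joyce-type intrinsic penalty `t^{B(p)}` (the weakly self-avoiding walk of BDGS 2012, §1.2,
(1.4)–(1.9) penalises self-intersection PAIRS instead) built on Lawler's cut times
[Lawler 1996, §1]. The object itself is posited by the route (not in print).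

## Contents (namespace `Literature.Probability.RandomPlanarGeometry.BlobTime`)

Definitions (all with bodies; `domainLaw_eq` restates the route's inlined term and is `rfl`):
* `walkWeight t p = criticalFugacity t ^ p.length * t ^ blobTime p` (any simple graph);
* `curveWeight t G δ a b` — the un-normalised measure `Σ_p w_t(p) δ_{curve(p)}` on
  `CurveClass ℂ` for walks of a graph `G` on the sites of `ℤ²` embedded by `meshPoint δ`;
  `curveLaw t G δ a b = (curveWeight … univ)⁻¹ • curveWeight …`;
* **`domainLaw t Ω δ a b := curveLaw t (discreteDomainGraph Ω δ) δ a b`** — THE NOTION;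
* the profile variant for a site-dependent blob fugacity `τ` (pointwise whole-plane critical):
  `profileWeight τ p = (∏_{j < |p|, j ∉ cutTimes p} τ(p_j)) · ∏_{j < |p|} y_c(τ(p_j))`,
  `curveWeightProfile`, `curveLawProfile`, **`domainLawProfile τ Ω δ a b`**, with
  `profileWeight_const : profileWeight (fun _ => t) p = walkWeight t p` and
  `domainLawProfile_const : domainLawProfile (fun _ => t) = domainLaw t`.

API (all proved):
* `domainLaw_eq` (`rfl`-unfolding to the term inlined in the route's items), `domainLaw_def`,
  `curveWeight_apply`, `curveWeight_univ` (total mass `Z_t = Σ_p w_t(p)`);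
* dichotomy `domainLaw_eq_zero_or_isProbabilityMeasure` (the statement of item BlobLawDichotomy,
  pure normalisation algebra via Mathlib's `isZeroOrProbabilityMeasureSMul`), and
  `isProbabilityMeasure_domainLaw_iff` (`↔ Z_t ∉ {0, ∞}`);
* `domainLaw_zero : domainLaw 0 Ω δ a b = (SAW.law Ω δ a b).map (·.curve)` (the statement of
  item BlobZeroIsSAW: `0 ^ B(p) = 𝟙{p is a path}`, `y_c(0) = x_c`, reindex over `DomainSAW`);
* `walkWeight_map` / `walkWeight_mapLe` (the weight is a function of the path: invariant under
  injective graph homomorphisms), `walkWeight_nonneg`, `walkWeight_zero_of_isPath`.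

Companion files: `BlobTimeDomainLawRestriction.lean` (exact restriction at graph level:
`curveWeight t G δ a b` is `curveWeight t H δ a b` summed over the walks of `H ≥ G` that use only
edges of `G`; reversal of cut times `mem_cutTimes_reverse_iff`, `walkWeight_reverse`, equality of
the total masses from `a` to `b` and from `b` to `a`) and `BlobTimeDomainLawReversal.lean`
(measure-level reversal `domainLaw t Ω δ b a = (domainLaw t Ω δ a b).map CurveClass.reverse` and
covariance under lattice symmetries, behind heavier imports). Not here: finiteness / positivity
of the total mass for bounded `Ω`, `δ > 0`, `t ∈ [0, 1]`.

## References

* G. F. Lawler, O. Schramm, W. Werner, *On the scaling limit of planar self-avoiding walk*,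
  Proc. Sympos. Pure Math. 72.2 (2004) 339–364, arXiv:math/0204277: §2 (the normalised
  measures `m^#(z, w; D)` and restriction covariance), §3.1 (`μ_SAW = β^{-|ω|}`), §3.4.2
  (measures on discrete paths of a domain considered as measures on curves), §3.4.5.
* R. Bauerschmidt, H. Duminil-Copin, J. Goodman, G. Slade, *Lectures on self-avoiding walks*,
  Clay Math. Proc. 15 (2012), arXiv:1206.2092, §1.2 (weakly self-avoiding walk, (1.4)–(1.9)).
* G. F. Lawler, *Cut times for simple random walk*, Electron. J. Probab. 1 (1996), paper 13, §1.

## Mathlib / tree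

`Measure.sum`, `map_smul`, `map_dirac'`, `isZeroOrProbabilityMeasureSMul`,
`Function.Injective.tsum_eq`. Tree: `BlobTime.cutTimes/cutCount/blobTime` (+ `_map`,
`_eq_zero_iff`; `BlobTime.lean`), `BlobTime.partitionSum/connectiveConstant/criticalFugacity`
(+ `criticalFugacity_zero`, `connectiveConstant_nonneg`; `BlobTimePartition.lean`),
`SAW.law/weight/DomainSAW.curve` (`SelfAvoidingWalk.lean`), `discreteDomainGraph`, `meshPoint`
(`DomainDiscretisation.lean`), `CurveClass` (`CurveSpace.lean`).
-/

noncomputable section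

open MeasureTheory SimpleGraph Literature.Probability.LatticeModels
open scoped ENNReal BigOperators

namespace Literature.Probability.RandomPlanarGeometry.BlobTime

/-! ### The weight of a walk -/

variable {V V' : Type*} {G : SimpleGraph V} {G' : SimpleGraph V'} {u v w : V}

/-- **The critical blob-time weight** `w_t(p) = y_c(t)^{|p|} · t^{B(p)}` of a walk `p`: fugacity
`y_c(t)` (the whole-plane critical fugacity `criticalFugacity t`) per step and a penalty `t` per
unit of blob time (route SAWCutPointCondensation; the case `t = 0` is LSW's `μ_SAW(ω) = β^{-|ω|}`
on self-avoiding `ω` and `0` otherwise, `walkWeight_zero_of_isPath`).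
[cite: LawlerSchrammWerner2004SAW, §3.1] -/
def walkWeight (t : ℝ) (p : G.Walk u v) : ℝ :=
  criticalFugacity t ^ p.length * t ^ blobTime p

/-- `w_t(p)` unfolded. [folklore] -/
theorem walkWeight_def (t : ℝ) (p : G.Walk u v) :
    walkWeight t p = criticalFugacity t ^ p.length * t ^ blobTime p := rfl

/-- The trivial walk has weight `1`. [folklore] -/
@[simp] theorem walkWeight_nil (t : ℝ) : walkWeight t (Walk.nil : G.Walk u u) = 1 := by
  simp [walkWeight]

/-- `0 ≤ w_t(p)` for `t ≥ 0` (`μ_B(t)` is an infimum of non-negative reals, so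
`y_c(t) = μ_B(t)⁻¹ ≥ 0`). [folklore] -/
theorem walkWeight_nonneg {t : ℝ} (ht : 0 ≤ t) (p : G.Walk u v) : 0 ≤ walkWeight t p := by
  refine mul_nonneg (pow_nonneg ?_ _) (pow_nonneg ht _)
  rw [criticalFugacity_eq, inv_nonneg]
  exact connectiveConstant_nonneg ht

/-- At `t = 0` a self-avoiding walk has weight `x_c^{|p|}` (`0 ^ B(p) = 0 ^ 0 = 1`,
`y_c(0) = x_c`). [cite: LawlerSchrammWerner2004SAW, §3.1] -/
theorem walkWeight_zero_of_isPath {p : G.Walk u v} (hp : p.IsPath) :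
    walkWeight 0 p = SAW.criticalFugacity ^ p.length := by
  rw [walkWeight, criticalFugacity_zero, (blobTime_eq_zero_iff p).2 hp, pow_zero, mul_one]

/-- At `t = 0` a walk that is not self-avoiding has weight `0` (`B(p) ≠ 0`). [folklore] -/
theorem walkWeight_zero_of_not_isPath {p : G.Walk u v} (hp : ¬ p.IsPath) : walkWeight 0 p = 0 := by
  rw [walkWeight, zero_pow (fun h => hp ((blobTime_eq_zero_iff p).1 h)), mul_zero]

/-- The weight is a function of the path: invariant under `Walk.map` of an injective graph
homomorphism (lattice symmetries, inclusions of subgraphs). [folklore] -/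
theorem walkWeight_map (t : ℝ) (f : G →g G') (hf : Function.Injective f) (p : G.Walk u v) :
    walkWeight t (p.map f) = walkWeight t p := by
  rw [walkWeight, blobTime_map f hf, Walk.length_map, walkWeight]

/-- The weight of a walk of a subgraph `G ≤ H` is the same in `H`. [folklore] -/
theorem walkWeight_mapLe (t : ℝ) {H : SimpleGraph V} (h : G ≤ H) (p : G.Walk u v) :
    walkWeight t (p.mapLe h) = walkWeight t p :=
  walkWeight_map t (Hom.ofLE h) (fun _ _ hxy => hxy) p

/-! ### The measures on curves -/

/-- The **un-normalised critical blob-time measure on curves** for walks from `a` to `b` of a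
graph `G` on the sites of `ℤ²`, at mesh `δ`: `Σ_{p : a → b} w_t(p) · δ_{curve(p)}`, where
`curve(p)` is the class of the polyline through the mesh points `δ p₀, …, δ p_L`
(`Walk.toCurve (meshPoint δ)`, as for `SAW.DomainSAW.curve`). A `Measure.sum` of weighted Dirac
masses indexed by the (countable) type of walks; `ENNReal.ofReal` truncates the (never intended)
negative weights at `t < 0` to `0`. [cite: LawlerSchrammWerner2004SAW, §3.4.2] -/
def curveWeight (t : ℝ) (G : SimpleGraph (Site 2)) (δ : ℝ) (a b : Site 2) :
    Measure (CurveClass ℂ) :=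
  Measure.sum fun p : G.Walk a b =>
    ENNReal.ofReal (walkWeight t p) • Measure.dirac (CurveClass.mk ⟨p.toCurve (meshPoint δ)⟩)

/-- The **normalised critical blob-time law on curves** for walks of `G` from `a` to `b`:
`(total mass)⁻¹ • curveWeight` (LSW's `m^# = m/|m|`). Junk value `0` if there is no walk from
`a` to `b` or if the total mass is infinite (Lean: `∞⁻¹ = 0`). [cite: LawlerSchrammWerner2004SAW, §3.4.2] -/
def curveLaw (t : ℝ) (G : SimpleGraph (Site 2)) (δ : ℝ) (a b : Site 2) : Measure (CurveClass ℂ) :=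
  (curveWeight t G δ a b Set.univ)⁻¹ • curveWeight t G δ a b

/-- **The critical blob-time chordal law `BL_t(Ω_δ; a, b)` of the discrete domain `Ω_δ ⊆ δℤ²`**
(`discreteDomainGraph Ω δ`) from `a` to `b`, on curves modulo reparametrisation: the
probability law `∝ Σ_p y_c(t)^{|p|} t^{B(p)} δ_{curve(p)}` over all nearest-neighbour walks
`p` of `Ω_δ` from `a` to `b` (junk `0` when `a`, `b` are not joined in `Ω_δ`). At `t = 0` this
is `SAW.law` pushed to curves (`domainLaw_zero`); `domainLaw_eq` is the term inlined in the
items of route SAWCutPointCondensation. [cite: LawlerSchrammWerner2004SAW, §3.4.2] -/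
def domainLaw (t : ℝ) (Ω : Set ℂ) (δ : ℝ) (a b : Site 2) : Measure (CurveClass ℂ) :=
  curveLaw t (discreteDomainGraph Ω δ) δ a b

open scoped Classical in
/-- `domainLaw` is, by `rfl`, the term inlined in the items of route SAWCutPointCondensation
(CutPointWindowLimit, …, BlobLawDichotomy), elaborated as there under `open scoped Classical`.
[folklore] -/
theorem domainLaw_eq (t : ℝ) (Ω : Set ℂ) (δ : ℝ) (a b : Site 2) :
    domainLaw t Ω δ a b =
      (fun S : Measure (CurveClass ℂ) => (S Set.univ)⁻¹ • S)
        (Measure.sum fun p : (discreteDomainGraph Ω δ).Walk a b =>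
          ENNReal.ofReal ((⨅ n : ℕ, (∑ v ∈ box 2 (n + 1),
              ∑ q ∈ (zdGraph 2).finsetWalkLength (n + 1) (0 : Site 2) v,
                t ^ (q.length - ((Finset.range q.length).filter fun j =>
                  ∀ i ∈ Finset.range (j + 1), ∀ k ∈ Finset.Ioc j q.length,
                    q.getVert i ≠ q.getVert k).card)) ^ (1 / ((n : ℝ) + 1)))⁻¹ ^ p.length *
            t ^ (p.length - ((Finset.range p.length).filter fun j =>
              ∀ i ∈ Finset.range (j + 1), ∀ k ∈ Finset.Ioc j p.length,
                p.getVert i ≠ p.getVert k).card)) •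
          Measure.dirac (CurveClass.mk ⟨p.toCurve (meshPoint δ)⟩)) :=
  rfl

/-- `domainLaw` unfolded one step. [folklore] -/
theorem domainLaw_def (t : ℝ) (Ω : Set ℂ) (δ : ℝ) (a b : Site 2) :
    domainLaw t Ω δ a b =
      (curveWeight t (discreteDomainGraph Ω δ) δ a b Set.univ)⁻¹ •
        curveWeight t (discreteDomainGraph Ω δ) δ a b :=
  rfl

section Measures

variable (t : ℝ) (G : SimpleGraph (Site 2)) (δ : ℝ) (a b : Site 2)

/-- The un-normalised measure of a Borel set of curves: `Σ_p w_t(p) 𝟙{curve(p) ∈ s}`. [folklore] -/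
theorem curveWeight_apply {s : Set (CurveClass ℂ)} (hs : MeasurableSet s) :
    curveWeight t G δ a b s =
      ∑' p : G.Walk a b, ENNReal.ofReal (walkWeight t p) *
        s.indicator 1 (CurveClass.mk ⟨p.toCurve (meshPoint δ)⟩) := by
  rw [curveWeight, Measure.sum_apply _ hs]
  simp only [Measure.smul_apply, smul_eq_mul, Measure.dirac_apply' _ hs]

/-- **Total mass** `Z_t = Σ_{p : a → b} w_t(p)`. [cite: LawlerSchrammWerner2004SAW, §3.4.2] -/
theorem curveWeight_univ :
    curveWeight t G δ a b Set.univ = ∑' p : G.Walk a b, ENNReal.ofReal (walkWeight t p) := by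
  rw [curveWeight_apply t G δ a b MeasurableSet.univ]
  simp

/-- **Dichotomy**: the normalised law is the zero measure (no walk, or infinite mass) or a
probability measure. [folklore] -/
instance isZeroOrProbabilityMeasure_curveLaw : IsZeroOrProbabilityMeasure (curveLaw t G δ a b) := by
  unfold curveLaw
  infer_instance

/-- **Dichotomy**: `curveLaw = 0 ∨ IsProbabilityMeasure curveLaw`. [folklore] -/
theorem curveLaw_eq_zero_or_isProbabilityMeasure :
    curveLaw t G δ a b = 0 ∨ IsProbabilityMeasure (curveLaw t G δ a b) :=
  eq_zero_or_isProbabilityMeasure _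

/-- The normalised law is a probability measure iff the total mass is neither `0` nor `∞`. [folklore] -/
theorem isProbabilityMeasure_curveLaw_iff :
    IsProbabilityMeasure (curveLaw t G δ a b) ↔
      curveWeight t G δ a b Set.univ ≠ 0 ∧ curveWeight t G δ a b Set.univ ≠ ∞ := by
  constructor
  · intro h
    have h1 := h.measure_univ
    rw [curveLaw, Measure.smul_apply, smul_eq_mul] at h1
    constructor
    · intro h0
      rw [h0, mul_zero] at h1
      exact zero_ne_one h1
    · intro htop
      rw [htop, ENNReal.inv_top, zero_mul] at h1
      exact zero_ne_one h1
  · rintro ⟨h0, htop⟩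
    refine ⟨?_⟩
    rw [curveLaw, Measure.smul_apply, smul_eq_mul, ENNReal.inv_mul_cancel h0 htop]

end Measures

/-- **Dichotomy for `BL_t(Ω_δ; a, b)`** (item BlobLawDichotomy of route SAWCutPointCondensation,
up to `domainLaw_eq`). [folklore] -/
instance isZeroOrProbabilityMeasure_domainLaw (t : ℝ) (Ω : Set ℂ) (δ : ℝ) (a b : Site 2) :
    IsZeroOrProbabilityMeasure (domainLaw t Ω δ a b) :=
  isZeroOrProbabilityMeasure_curveLaw t _ δ a b

/-- **Dichotomy for `BL_t(Ω_δ; a, b)`**: zero or a probability measure, for every real `t` and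
all `Ω, δ, a, b`. [folklore] -/
theorem domainLaw_eq_zero_or_isProbabilityMeasure (t : ℝ) (Ω : Set ℂ) (δ : ℝ) (a b : Site 2) :
    domainLaw t Ω δ a b = 0 ∨ IsProbabilityMeasure (domainLaw t Ω δ a b) :=
  eq_zero_or_isProbabilityMeasure _

/-- `BL_t(Ω_δ; a, b)` is a probability measure iff its total mass `Z_t` is neither `0` nor `∞`. [folklore] -/
theorem isProbabilityMeasure_domainLaw_iff (t : ℝ) (Ω : Set ℂ) (δ : ℝ) (a b : Site 2) :
    IsProbabilityMeasure (domainLaw t Ω δ a b) ↔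
      curveWeight t (discreteDomainGraph Ω δ) δ a b Set.univ ≠ 0 ∧
        curveWeight t (discreteDomainGraph Ω δ) δ a b Set.univ ≠ ∞ :=
  isProbabilityMeasure_curveLaw_iff t _ δ a b

/-! ### `t = 0`: the critical self-avoiding walk -/

section Zero

variable (Ω : Set ℂ) (δ : ℝ) (a b : Site 2)

/-- At `t = 0` the un-normalised blob-time measure is the critical SAW measure `SAW.weight`
(`x_c^{|γ|}` on self-avoiding `γ`) pushed to curves: walks that are not paths get weight `0`,
paths get `x_c^{|p|}`; reindex along `DomainSAW Ω δ a b ↪ (Ω_δ).Walk a b`.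
[cite: LawlerSchrammWerner2004SAW, §3.1] -/
theorem map_curve_weight (Ω : Set ℂ) (δ : ℝ) (a b : Site 2) :
    (SAW.weight Ω δ a b).map (fun γ => γ.curve) = curveWeight 0 (discreteDomainGraph Ω δ) δ a b := by
  ext s hs
  rw [Measure.map_apply (SAW.DomainSAW.measurable_of_top _) hs, SAW.weight,
    Measure.sum_apply _ MeasurableSpace.measurableSet_top, curveWeight_apply _ _ _ _ _ hs]
  simp only [Measure.smul_apply, smul_eq_mul,
    Measure.dirac_apply' _ (MeasurableSpace.measurableSet_top : MeasurableSet ((fun γ :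
      SAW.DomainSAW Ω δ a b => γ.curve) ⁻¹' s))]
  have hg : Function.Injective (fun γ : SAW.DomainSAW Ω δ a b => γ.walk) := by
    rintro ⟨p, hp⟩ ⟨q, hq⟩ h
    cases h
    rfl
  rw [← hg.tsum_eq (f := fun p : (discreteDomainGraph Ω δ).Walk a b =>
    ENNReal.ofReal (walkWeight 0 p) * s.indicator 1 (CurveClass.mk ⟨p.toCurve (meshPoint δ)⟩))]
  · refine tsum_congr fun γ => ?_
    simp only [walkWeight_zero_of_isPath γ.isPath]
    rfl
  · intro p hp
    rw [Function.mem_support] at hp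
    have hpath : p.IsPath := by
      by_contra h
      exact hp (by rw [walkWeight_zero_of_not_isPath h, ENNReal.ofReal_zero, zero_mul])
    exact ⟨⟨p, hpath⟩, rfl⟩

/-- **`BL_0 = SAW.law` pushed to curves** (item BlobZeroIsSAW of route SAWCutPointCondensation,
up to `domainLaw_eq`): at blob fugacity `t = 0` the critical blob-time chordal law of `Ω_δ`
from `a` to `b` is the law of the critical self-avoiding walk (`SAW.law Ω δ a b`, weight
`x_c^{|γ|}`) pushed forward along `DomainSAW.curve`; the junk cases agree because the total
masses coincide. [cite: LawlerSchrammWerner2004SAW, §3.4.2] -/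
theorem domainLaw_zero : domainLaw 0 Ω δ a b = (SAW.law Ω δ a b).map (fun γ => γ.curve) := by
  rw [SAW.law, Measure.map_smul, map_curve_weight, domainLaw, curveLaw]
  congr 2
  rw [← map_curve_weight, Measure.map_apply (SAW.DomainSAW.measurable_of_top _) MeasurableSet.univ,
    Set.preimage_univ]

end Zero

/-! ### The profile variant: a site-dependent blob fugacity -/

/-- **Profile weight**: for a site-dependent blob fugacity `τ : V → ℝ`, the pointwise
whole-plane-critical weight `(∏_{j < |p|, j ∉ cutTimes p} τ(p_j)) · ∏_{j < |p|} y_c(τ(p_j))`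
(each non-cut time `j` pays the local penalty `τ(p_j)`, every step the local critical fugacity
`y_c(τ(p_j))`); for constant `τ ≡ t` this is `walkWeight t` (`profileWeight_const`). Needed for
the profile split of CondensateCovariance (route SAWCutPointCondensation). [folklore] -/
def profileWeight (τ : V → ℝ) (p : G.Walk u v) : ℝ :=
  (∏ j ∈ Finset.range p.length \ cutTimes p, τ (p.getVert j)) *
    ∏ j ∈ Finset.range p.length, criticalFugacity (τ (p.getVert j))

/-- A constant profile gives the blob-time weight: `#(range |p| ∖ cutTimes p) = B(p)`. [folklore] -/
theorem profileWeight_const (t : ℝ) (p : G.Walk u v) :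
    profileWeight (fun _ => t) p = walkWeight t p := by
  rw [profileWeight, walkWeight, Finset.prod_const, Finset.prod_const, Finset.card_range,
    Finset.card_sdiff_of_subset (cutTimes_subset_range p), Finset.card_range, mul_comm]
  rfl

/-- The un-normalised profile measure on curves `Σ_p w_τ(p) δ_{curve(p)}`. [folklore] -/
def curveWeightProfile (τ : Site 2 → ℝ) (G : SimpleGraph (Site 2)) (δ : ℝ) (a b : Site 2) :
    Measure (CurveClass ℂ) :=
  Measure.sum fun p : G.Walk a b =>
    ENNReal.ofReal (profileWeight τ p) • Measure.dirac (CurveClass.mk ⟨p.toCurve (meshPoint δ)⟩)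

/-- The normalised profile law on curves. [folklore] -/
def curveLawProfile (τ : Site 2 → ℝ) (G : SimpleGraph (Site 2)) (δ : ℝ) (a b : Site 2) :
    Measure (CurveClass ℂ) :=
  (curveWeightProfile τ G δ a b Set.univ)⁻¹ • curveWeightProfile τ G δ a b

/-- **The profile blob-time chordal law `BL_τ(Ω_δ; a, b)`** of the discrete domain `Ω_δ` with a
site-dependent blob fugacity `τ : ℤ² → ℝ` (pointwise whole-plane critical), on curves modulo
reparametrisation; `domainLawProfile (fun _ => t) = domainLaw t` (`domainLawProfile_const`). [folklore] -/
def domainLawProfile (τ : Site 2 → ℝ) (Ω : Set ℂ) (δ : ℝ) (a b : Site 2) : Measure (CurveClass ℂ) :=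
  curveLawProfile τ (discreteDomainGraph Ω δ) δ a b

/-- A constant profile gives `curveWeight`. [folklore] -/
theorem curveWeightProfile_const (t : ℝ) (G : SimpleGraph (Site 2)) (δ : ℝ) (a b : Site 2) :
    curveWeightProfile (fun _ => t) G δ a b = curveWeight t G δ a b := by
  simp only [curveWeightProfile, curveWeight, profileWeight_const]

/-- A constant profile gives `curveLaw`. [folklore] -/
theorem curveLawProfile_const (t : ℝ) (G : SimpleGraph (Site 2)) (δ : ℝ) (a b : Site 2) :
    curveLawProfile (fun _ => t) G δ a b = curveLaw t G δ a b := by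
  rw [curveLawProfile, curveWeightProfile_const, curveLaw]

/-- **A constant profile gives `BL_t`**: `domainLawProfile (fun _ => t) = domainLaw t`. [folklore] -/
theorem domainLawProfile_const (t : ℝ) (Ω : Set ℂ) (δ : ℝ) (a b : Site 2) :
    domainLawProfile (fun _ => t) Ω δ a b = domainLaw t Ω δ a b :=
  curveLawProfile_const t _ δ a b

/-- Dichotomy for the profile law. [folklore] -/
instance isZeroOrProbabilityMeasure_domainLawProfile (τ : Site 2 → ℝ) (Ω : Set ℂ) (δ : ℝ)
    (a b : Site 2) : IsZeroOrProbabilityMeasure (domainLawProfile τ Ω δ a b) := by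
  unfold domainLawProfile curveLawProfile
  infer_instance

end Literature.Probability.RandomPlanarGeometry.BlobTime
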